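import Summits.HodgeConjecture.HodgeCM.Model.PadH0_1

/-! PORT of `HodgeCM/Model/PadH0.lean` (HodgeCMPerL run 82) — part 2: continuation of `Summits.HodgeConjecture.HodgeCM.Model.PadH0_1` (split at a top-level declaration boundary by port_pkg.py; scope re-opened below; declarations unchanged). -/

-- port_pkg: scope re-opened for this part (file-level context, then the namespace/section stack open at the cut)
noncomputable section
open scoped TensorProduct
namespace HodgeCM
open Literature.AlgebraicGeometry.Motives (CMType HodgeStructure)
open Literature.AlgebraicGeometry.Motives.HodgeStructure (EndAction ofRat conj complexConj prodEquiv pureFiltration)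
namespace Universe
variable (U : Universe)
namespace PadH0
variable {U} (D : U.PadDatum)
/-- the inclusion of the geometric summand (the identity off degree `0`) -/
def ofU (X : U.Var) (k : ℕ) : U.Coh X k →ₗ[ℚ] (U.padH0 D).Coh X k := PadZero.inl (U.Coh X k) (D.P X) k

/-- the inclusion of the pad (zero off degree `0`) -/
def ofPad (X : U.Var) (k : ℕ) : D.P X →ₗ[ℚ] (U.padH0 D).Coh X k := PadZero.inr (U.Coh X k) (D.P X) k

variable {D}

/-- (Ported verbatim from the HodgeCMPerL package; no docstring in the source.) -/
@[simp] theorem toU_ofU (X : U.Var) (k : ℕ) (x : U.Coh X k) : toU D X k (ofU D X k x) = x := PadZero.fst_inl k x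

/-- (Ported verbatim from the HodgeCMPerL package; no docstring in the source.) -/
@[simp] theorem padOf_ofU (X : U.Var) (k : ℕ) (x : U.Coh X k) : padOf D X k (ofU D X k x) = 0 :=
  PadZero.snd_inl k x

/-- (Ported verbatim from the HodgeCMPerL package; no docstring in the source.) -/
@[simp] theorem toU_ofPad (X : U.Var) (k : ℕ) (v : D.P X) : toU D X k (ofPad D X k v) = 0 := PadZero.fst_inr k v

/-- (Ported verbatim from the HodgeCMPerL package; no docstring in the source.) -/
theorem ofU_toU_add (X : U.Var) (k : ℕ) (x : (U.padH0 D).Coh X k) :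
    ofU D X k (toU D X k x) + ofPad D X k (padOf D X k x) = x :=
  PadZero.inl_fst_add_inr_snd k x

/-- (Ported verbatim from the HodgeCMPerL package; no docstring in the source.) -/
theorem ext_iff (X : U.Var) (k : ℕ) (x y : (U.padH0 D).Coh X k) :
    x = y ↔ toU D X k x = toU D X k y ∧ padOf D X k x = padOf D X k y :=
  PadZero.ext_iff' k x y

/-- (Ported verbatim from the HodgeCMPerL package; no docstring in the source.) -/
theorem ofU_toU_of_ne (X : U.Var) {k : ℕ} (hk : k ≠ 0) (x : (U.padH0 D).Coh X k) : ofU D X k (toU D X k x) = x :=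
  PadZero.inl_fst_of_ne hk x

/-- (Ported verbatim from the HodgeCMPerL package; no docstring in the source.) -/
theorem padOf_of_ne (X : U.Var) {k : ℕ} (hk : k ≠ 0) (x : (U.padH0 D).Coh X k) : padOf D X k x = 0 :=
  PadZero.snd_of_ne hk x

/-- (Ported verbatim from the HodgeCMPerL package; no docstring in the source.) -/
theorem ofPad_of_ne (X : U.Var) {k : ℕ} (hk : k ≠ 0) (v : D.P X) : ofPad D X k v = (0 : (U.padH0 D).Coh X k) :=
  PadZero.inr_of_ne hk v

/-- (Ported verbatim from the HodgeCMPerL package; no docstring in the source.) -/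
theorem toU_bijective_of_ne (X : U.Var) {k : ℕ} (hk : k ≠ 0) : Function.Bijective (toU D X k) :=
  PadZero.fst_bijective_of_ne hk

/-- (Ported verbatim from the HodgeCMPerL package; no docstring in the source.) -/
theorem ofU_injective (X : U.Var) (k : ℕ) : Function.Injective (ofU D X k) := PadZero.inl_injective k

/-- (Ported verbatim from the HodgeCMPerL package; no docstring in the source.) -/
theorem ofU_bijective_of_ne (X : U.Var) {k : ℕ} (hk : k ≠ 0) : Function.Bijective (ofU D X k) :=
  ⟨ofU_injective X k, fun x => ⟨toU D X k x, ofU_toU_of_ne X hk x⟩⟩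

/-- degree zero, concretely: `H♭⁰(X) = H⁰(X) × P(X)` and the four maps are the product maps -/
theorem toU_zero (X : U.Var) (x : (U.padH0 D).Coh X 0) : toU D X 0 x = x.1 := rfl

/-- (Ported verbatim from the HodgeCMPerL package; no docstring in the source.) -/
theorem padOf_zero (X : U.Var) (x : (U.padH0 D).Coh X 0) : padOf D X 0 x = x.2 := rfl

/-- (Ported verbatim from the HodgeCMPerL package; no docstring in the source.) -/
theorem ofU_zero (X : U.Var) (x : U.Coh X 0) : ofU D X 0 x = (x, 0) := rfl

/-- (Ported verbatim from the HodgeCMPerL package; no docstring in the source.) -/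
theorem ofPad_zero (X : U.Var) (v : D.P X) : ofPad D X 0 v = ((0, v) : U.Coh X 0 × D.P X) := rfl

/-- (Ported verbatim from the HodgeCMPerL package; no docstring in the source.) -/
@[simp] theorem padOf_ofPad_zero (X : U.Var) (v : D.P X) : padOf D X 0 (ofPad D X 0 v) = v := rfl

/-! ### pull-backs, cup products, traces, algebraic classes, degree casts -/

/-- (Ported verbatim from the HodgeCMPerL package; no docstring in the source.) -/
theorem toU_pull {X Y : U.Var} (f : U.Mor X Y) (k : ℕ) (y : (U.padH0 D).Coh Y k) :
    toU D X k ((U.padH0 D).pull f k y) = U.pull f k (toU D Y k y) :=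
  PadZero.fst_map k _ _ y

/-- (Ported verbatim from the HodgeCMPerL package; no docstring in the source.) -/
theorem padOf_pull {X Y : U.Var} (f : U.Mor X Y) (k : ℕ) (y : (U.padH0 D).Coh Y k) :
    padOf D X k ((U.padH0 D).pull f k y) = D.map f (padOf D Y k y) :=
  PadZero.snd_map k _ _ y

/-- (Ported verbatim from the HodgeCMPerL package; no docstring in the source.) -/
theorem pull_ofU {X Y : U.Var} (f : U.Mor X Y) (k : ℕ) (y : U.Coh Y k) :
    (U.padH0 D).pull f k (ofU D Y k y) = ofU D X k (U.pull f k y) :=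
  PadZero.map_inl k _ _ y

/-- (Ported verbatim from the HodgeCMPerL package; no docstring in the source.) -/
theorem pull_ofPad {X Y : U.Var} (f : U.Mor X Y) (k : ℕ) (v : D.P Y) :
    (U.padH0 D).pull f k (ofPad D Y k v) = ofPad D X k (D.map f v) :=
  PadZero.map_inr k _ _ v

/-- (Ported verbatim from the HodgeCMPerL package; no docstring in the source.) -/
theorem toU_comp_pull {X Y : U.Var} (f : U.Mor X Y) (k : ℕ) :
    toU D X k ∘ₗ (U.padH0 D).pull f k = U.pull f k ∘ₗ toU D Y k :=
  LinearMap.ext (toU_pull f k)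

/-- (Ported verbatim from the HodgeCMPerL package; no docstring in the source.) -/
theorem padOf_comp_pull {X Y : U.Var} (f : U.Mor X Y) (k : ℕ) :
    padOf D X k ∘ₗ (U.padH0 D).pull f k = D.map f ∘ₗ padOf D Y k :=
  LinearMap.ext (padOf_pull f k)

/-- (Ported verbatim from the HodgeCMPerL package; no docstring in the source.) -/
theorem cup_def (X : U.Var) (i j : ℕ) (x : (U.padH0 D).Coh X i) (y : (U.padH0 D).Coh X j) :
    (U.padH0 D).cup X i j x y = ofU D X (i + j) (U.cup X i j (toU D X i x) (toU D X j y)) := rfl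

/-- (Ported verbatim from the HodgeCMPerL package; no docstring in the source.) -/
theorem toU_cup (X : U.Var) (i j : ℕ) (x : (U.padH0 D).Coh X i) (y : (U.padH0 D).Coh X j) :
    toU D X (i + j) ((U.padH0 D).cup X i j x y) = U.cup X i j (toU D X i x) (toU D X j y) :=
  PadZero.fst_inl (i + j) _

/-- (Ported verbatim from the HodgeCMPerL package; no docstring in the source.) -/
theorem padOf_cup (X : U.Var) (i j : ℕ) (x : (U.padH0 D).Coh X i) (y : (U.padH0 D).Coh X j) :
    padOf D X (i + j) ((U.padH0 D).cup X i j x y) = 0 :=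
  PadZero.snd_inl (i + j) _

/-- (Ported verbatim from the HodgeCMPerL package; no docstring in the source.) -/
theorem tr_apply (X : U.Var) (k : ℕ) (x : (U.padH0 D).Coh X k) : (U.padH0 D).tr X k x = U.tr X k (toU D X k x) := rfl

/-- (Ported verbatim from the HodgeCMPerL package; no docstring in the source.) -/
theorem mem_alg_iff (X : U.Var) (p : ℕ) (x : (U.padH0 D).Coh X (2 * p)) :
    x ∈ (U.padH0 D).alg X p ↔ toU D X (2 * p) x ∈ U.alg X p ∧ padOf D X (2 * p) x = 0 :=
  PadZero.mem_sub_iff (2 * p) _ x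

/-- (Ported verbatim from the HodgeCMPerL package; no docstring in the source.) -/
theorem ofU_mem_alg (X : U.Var) (p : ℕ) {x : U.Coh X (2 * p)} (hx : x ∈ U.alg X p) :
    ofU D X (2 * p) x ∈ (U.padH0 D).alg X p :=
  (mem_alg_iff X p _).mpr ⟨(toU_ofU (D := D) X _ x).symm ▸ hx, padOf_ofU X _ x⟩

/-- (Ported verbatim from the HodgeCMPerL package; no docstring in the source.) -/
theorem toU_castCoh (X : U.Var) {k l : ℕ} (h : k = l) (x : (U.padH0 D).Coh X k) :
    toU D X l ((U.padH0 D).castCoh X h x) = U.castCoh X h (toU D X k x) := by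
  subst h; rfl

/-- (Ported verbatim from the HodgeCMPerL package; no docstring in the source.) -/
theorem padOf_castCoh (X : U.Var) {k l : ℕ} (h : k = l) (x : (U.padH0 D).Coh X k) :
    padOf D X l ((U.padH0 D).castCoh X h x) = padOf D X k x := by
  subst h; rfl

/-! ### complexification -/

variable (D) in
/-- the geometric summand of `H♭^k(X, ℂ)` -/
def toUC (X : U.Var) (k : ℕ) : (U.padH0 D).CohC X k →ₗ[ℂ] U.CohC X k := (toU D X k).baseChange ℂ

variable (D) in
/-- the pad component of `H♭^k(X, ℂ)` -/
def padOfC (X : U.Var) (k : ℕ) : (U.padH0 D).CohC X k →ₗ[ℂ] ℂ ⊗[ℚ] D.P X := (padOf D X k).baseChange ℂ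

variable (D) in
/-- the geometric summand, included -/
def ofUC (X : U.Var) (k : ℕ) : U.CohC X k →ₗ[ℂ] (U.padH0 D).CohC X k := (ofU D X k).baseChange ℂ

variable (D) in
/-- the pad, included -/
def ofPadC (X : U.Var) (k : ℕ) : ℂ ⊗[ℚ] D.P X →ₗ[ℂ] (U.padH0 D).CohC X k := (ofPad D X k).baseChange ℂ

/-- (Ported verbatim from the HodgeCMPerL package; no docstring in the source.) -/
theorem toUC_tmul (X : U.Var) (k : ℕ) (c : ℂ) (x : (U.padH0 D).Coh X k) : toUC D X k (c ⊗ₜ x) = c ⊗ₜ toU D X k x := rfl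

/-- (Ported verbatim from the HodgeCMPerL package; no docstring in the source.) -/
theorem padOfC_tmul (X : U.Var) (k : ℕ) (c : ℂ) (x : (U.padH0 D).Coh X k) :
    padOfC D X k (c ⊗ₜ x) = c ⊗ₜ padOf D X k x :=
  rfl

/-- (Ported verbatim from the HodgeCMPerL package; no docstring in the source.) -/
theorem ofUC_tmul (X : U.Var) (k : ℕ) (c : ℂ) (x : U.Coh X k) : ofUC D X k (c ⊗ₜ x) = c ⊗ₜ ofU D X k x := rfl

/-- (Ported verbatim from the HodgeCMPerL package; no docstring in the source.) -/
theorem ofPadC_tmul (X : U.Var) (k : ℕ) (c : ℂ) (v : D.P X) : ofPadC D X k (c ⊗ₜ v) = c ⊗ₜ ofPad D X k v := rfl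

/-- (Ported verbatim from the HodgeCMPerL package; no docstring in the source.) -/
theorem toUC_ofRat (X : U.Var) (k : ℕ) (x : (U.padH0 D).Coh X k) : toUC D X k (ofRat x) = ofRat (toU D X k x) :=
  PadZero.baseChange_ofRat _ x

/-- (Ported verbatim from the HodgeCMPerL package; no docstring in the source.) -/
theorem padOfC_ofRat (X : U.Var) (k : ℕ) (x : (U.padH0 D).Coh X k) : padOfC D X k (ofRat x) = ofRat (padOf D X k x) :=
  PadZero.baseChange_ofRat _ x

/-- (Ported verbatim from the HodgeCMPerL package; no docstring in the source.) -/
theorem ofUC_ofRat (X : U.Var) (k : ℕ) (x : U.Coh X k) : ofUC D X k (ofRat x) = ofRat (ofU D X k x) :=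
  PadZero.baseChange_ofRat _ x

/-- (Ported verbatim from the HodgeCMPerL package; no docstring in the source.) -/
theorem ofPadC_ofRat (X : U.Var) (k : ℕ) (v : D.P X) : ofPadC D X k (ofRat v) = ofRat (ofPad D X k v) :=
  PadZero.baseChange_ofRat _ v

/-- (Ported verbatim from the HodgeCMPerL package; no docstring in the source.) -/
theorem toUC_ofUC (X : U.Var) (k : ℕ) (x : U.CohC X k) : toUC D X k (ofUC D X k x) = x := by
  induction x using TensorProduct.induction_on with
  | zero => simp only [map_zero]
  | tmul c x => rw [ofUC_tmul, toUC_tmul, toU_ofU]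
  | add x y hx hy => rw [map_add, map_add, hx, hy]

/-- (Ported verbatim from the HodgeCMPerL package; no docstring in the source.) -/
theorem padOfC_ofUC (X : U.Var) (k : ℕ) (x : U.CohC X k) : padOfC D X k (ofUC D X k x) = 0 := by
  induction x using TensorProduct.induction_on with
  | zero => simp only [map_zero]
  | tmul c x => rw [ofUC_tmul, padOfC_tmul, padOf_ofU, TensorProduct.tmul_zero]
  | add x y hx hy => rw [map_add, map_add, hx, hy, add_zero]

/-- (Ported verbatim from the HodgeCMPerL package; no docstring in the source.) -/
theorem padOfC_ofPadC_zero (X : U.Var) (v : ℂ ⊗[ℚ] D.P X) : padOfC D X 0 (ofPadC D X 0 v) = v := by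
  induction v using TensorProduct.induction_on with
  | zero => simp only [map_zero]
  | tmul c x => rw [ofPadC_tmul, padOfC_tmul, padOf_ofPad_zero]
  | add x y hx hy => rw [map_add, map_add, hx, hy]

/-- (Ported verbatim from the HodgeCMPerL package; no docstring in the source.) -/
theorem toUC_ofPadC (X : U.Var) (k : ℕ) (v : ℂ ⊗[ℚ] D.P X) : toUC D X k (ofPadC D X k v) = 0 := by
  induction v using TensorProduct.induction_on with
  | zero => simp only [map_zero]
  | tmul c x => rw [ofPadC_tmul, toUC_tmul, toU_ofPad, TensorProduct.tmul_zero]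
  | add x y hx hy => rw [map_add, map_add, hx, hy, add_zero]

/-- (Ported verbatim from the HodgeCMPerL package; no docstring in the source.) -/
theorem padOfC_of_ne (X : U.Var) {k : ℕ} (hk : k ≠ 0) (x : (U.padH0 D).CohC X k) : padOfC D X k x = 0 := by
  have h : padOf D X k = 0 := LinearMap.ext (padOf_of_ne X hk)
  rw [padOfC, h, LinearMap.baseChange_zero, LinearMap.zero_apply]

/-- `x = ofU (toU x) + ofPad (padOf x)`, complexified -/
theorem ofUC_toUC_add (X : U.Var) (k : ℕ) (x : (U.padH0 D).CohC X k) :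
    ofUC D X k (toUC D X k x) + ofPadC D X k (padOfC D X k x) = x := by
  induction x using TensorProduct.induction_on with
  | zero => simp only [map_zero, add_zero]
  | tmul c x => rw [toUC_tmul, padOfC_tmul, ofUC_tmul, ofPadC_tmul, ← TensorProduct.tmul_add, ofU_toU_add]
  | add x y hx hy => rw [map_add, map_add, map_add, map_add, add_add_add_comm, hx, hy]

/-- (Ported verbatim from the HodgeCMPerL package; no docstring in the source.) -/
theorem extC_iff (X : U.Var) (k : ℕ) (x y : (U.padH0 D).CohC X k) :
    x = y ↔ toUC D X k x = toUC D X k y ∧ padOfC D X k x = padOfC D X k y := by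
  constructor
  · rintro rfl; exact ⟨rfl, rfl⟩
  · rintro ⟨h1, h2⟩
    rw [← ofUC_toUC_add X k x, ← ofUC_toUC_add X k y, h1, h2]

/-- **The Hodge filtration of `U♭`, componentwise**: the geometric component lies in `F^p H^k(X)` and the pad component in
`F^p` of the pad structure `D.hs X` (vacuous off degree `0`, where the pad component is `0`). -/
theorem mem_F_iff (X : U.Var) (k : ℕ) (p : ℤ) (x : (U.padH0 D).CohC X k) :
    x ∈ ((U.padH0 D).hodge X k).F p ↔ toUC D X k x ∈ (U.hodge X k).F p ∧ padOfC D X k x ∈ (D.hs X).F p :=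
  PadZero.mem_hodge_F_iff k (U.hodge X k) (D.hs X) p x

/-- (Ported verbatim from the HodgeCMPerL package; no docstring in the source.) -/
theorem toUC_pullC {X Y : U.Var} (f : U.Mor X Y) (k : ℕ) (y : (U.padH0 D).CohC Y k) :
    toUC D X k ((U.padH0 D).pullC f k y) = U.pullC f k (toUC D Y k y) := by
  have h := congrArg (fun g : (U.padH0 D).Coh Y k →ₗ[ℚ] U.Coh X k => g.baseChange ℂ y) (toU_comp_pull (D := D) f k)
  simp only [LinearMap.baseChange_comp, LinearMap.comp_apply] at h
  exact h

/-- (Ported verbatim from the HodgeCMPerL package; no docstring in the source.) -/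
theorem padOfC_pullC {X Y : U.Var} (f : U.Mor X Y) (k : ℕ) (y : (U.padH0 D).CohC Y k) :
    padOfC D X k ((U.padH0 D).pullC f k y) = (D.map f).baseChange ℂ (padOfC D Y k y) := by
  have h := congrArg (fun g : (U.padH0 D).Coh Y k →ₗ[ℚ] D.P X => g.baseChange ℂ y) (padOf_comp_pull (D := D) f k)
  simp only [LinearMap.baseChange_comp, LinearMap.comp_apply] at h
  exact h

/-- (Ported verbatim from the HodgeCMPerL package; no docstring in the source.) -/
theorem pullC_ofUC {X Y : U.Var} (f : U.Mor X Y) (k : ℕ) (y : U.CohC Y k) :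
    (U.padH0 D).pullC f k (ofUC D Y k y) = ofUC D X k (U.pullC f k y) := by
  induction y using TensorProduct.induction_on with
  | zero => simp only [map_zero]
  | tmul c y => rw [ofUC_tmul, pullC, LinearMap.baseChange_tmul, pull_ofU, pullC, LinearMap.baseChange_tmul, ofUC_tmul]
  | add x y hx hy => rw [map_add, map_add, hx, hy, map_add, map_add]

/-- (Ported verbatim from the HodgeCMPerL package; no docstring in the source.) -/
theorem toUC_cupC (X : U.Var) (i j : ℕ) (x : (U.padH0 D).CohC X i) (y : (U.padH0 D).CohC X j) :
    toUC D X (i + j) ((U.padH0 D).cupC X i j x y) = U.cupC X i j (toUC D X i x) (toUC D X j y) := by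
  induction x using TensorProduct.induction_on with
  | zero => simp only [map_zero, LinearMap.zero_apply]
  | tmul a x =>
    induction y using TensorProduct.induction_on with
    | zero => simp only [map_zero]
    | tmul b y => rw [cupC_tmul, toUC_tmul, toUC_tmul, toUC_tmul, cupC_tmul, toU_cup]
    | add y₁ y₂ h₁ h₂ => rw [map_add, map_add, h₁, h₂, map_add, map_add]
  | add x₁ x₂ h₁ h₂ => rw [map_add, LinearMap.add_apply, map_add, h₁, h₂, map_add, map_add, LinearMap.add_apply]

/-- (Ported verbatim from the HodgeCMPerL package; no docstring in the source.) -/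
theorem padOfC_cupC (X : U.Var) (i j : ℕ) (x : (U.padH0 D).CohC X i) (y : (U.padH0 D).CohC X j) :
    padOfC D X (i + j) ((U.padH0 D).cupC X i j x y) = 0 := by
  induction x using TensorProduct.induction_on with
  | zero => simp only [map_zero, LinearMap.zero_apply]
  | tmul a x =>
    induction y using TensorProduct.induction_on with
    | zero => simp only [map_zero]
    | tmul b y => rw [cupC_tmul, padOfC_tmul, padOf_cup, TensorProduct.tmul_zero]
    | add y₁ y₂ h₁ h₂ => rw [map_add, map_add, h₁, h₂, add_zero]
  | add x₁ x₂ h₁ h₂ => rw [map_add, LinearMap.add_apply, map_add, h₁, h₂, add_zero]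

/-- rational Hodge classes of `U♭`, componentwise -/
theorem ofRat_mem_F_iff (X : U.Var) (k : ℕ) (p : ℤ) (x : (U.padH0 D).Coh X k) :
    (ofRat x : (U.padH0 D).CohC X k) ∈ ((U.padH0 D).hodge X k).F p ↔
      (ofRat (toU D X k x) : U.CohC X k) ∈ (U.hodge X k).F p ∧ (ofRat (padOf D X k x) : ℂ ⊗[ℚ] D.P X) ∈ (D.hs X).F p := by
  rw [mem_F_iff, toUC_ofRat, padOfC_ofRat]

/-- A rational Hodge class of `U♭` of codimension `p` has a Hodge-class geometric component and a pad component which is a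
rational Hodge class of the pad structure (filtration level `p`). -/
theorem mem_hodgeClassesOf_iff (X : U.Var) (p : ℕ) (x : (U.padH0 D).Coh X (2 * p)) :
    x ∈ (U.padH0 D).hodgeClassesOf X p ↔
      toU D X (2 * p) x ∈ U.hodgeClassesOf X p ∧ padOf D X (2 * p) x ∈ (D.hs X).hodgeClasses (p : ℤ) :=
  ofRat_mem_F_iff X (2 * p) p x

/-! ## 3. Transport of the composite notions -/

/-- Commutation squares of pull-backs of `U♭`, in all degrees, give those of `U` (project to the geometric summand). -/
theorem pull_comm_toU {W X Y Z : U.Var} (f : U.Mor W X) (g : U.Mor X Y) (f' : U.Mor Z Y) (g' : U.Mor W Z)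
    (h : ∀ k, (U.padH0 D).pull f k ∘ₗ (U.padH0 D).pull g k = (U.padH0 D).pull g' k ∘ₗ (U.padH0 D).pull f' k) (k : ℕ) :
    U.pull f k ∘ₗ U.pull g k = U.pull g' k ∘ₗ U.pull f' k := by
  ext y
  have h' := LinearMap.congr_fun (h k) (ofU D Y k y)
  rw [LinearMap.comp_apply, LinearMap.comp_apply] at h'
  have h'' := congrArg (toU D W k) h'
  rw [toU_pull, toU_pull, toU_ofU, toU_pull, toU_pull, toU_ofU] at h''
  rw [LinearMap.comp_apply, LinearMap.comp_apply]
  exact h''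

/-- Diagonal actions on the four-corner products of `U♭` are diagonal actions of `U`. -/
theorem isDiagAct_toU {K : CMField} {Φ : Fin 4 → CMType K} {a : K} {M : U.Mor (U.prod4 K Φ) (U.prod4 K Φ)}
    (h : (U.padH0 D).IsDiagAct K Φ a M) : U.IsDiagAct K Φ a M := by
  obtain ⟨e, he1, he2⟩ := h
  exact ⟨e, he1, fun i => pull_comm_toU M (U.pr4 K Φ i) (e i) (U.pr4 K Φ i) (he2 i)⟩

/-- (Ported verbatim from the HodgeCMPerL package; no docstring in the source.) -/
theorem dim_prod4 (M : U.ModelAxioms) (hd : U.Fact_dimProd) (K : CMField) (Φ : Fin 4 → CMType K) :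
    U.dim (U.prod4 K Φ) = 4 * K.halfDegree := by
  have hd' : ∀ X Y : U.Var, U.dim (U.prod X Y) = U.dim X + U.dim Y := hd
  have hc : ∀ Ψ : CMType K, U.dim (U.cmAV K Ψ) = K.halfDegree := fun Ψ => (M.cmAV K Ψ).2.2
  show U.dim (U.prod (U.prod (U.prod _ _) _) _) = _
  rw [hd', hd', hd', hc, hc, hc, hc]
  ring

/-- (Ported verbatim from the HodgeCMPerL package; no docstring in the source.) -/
theorem one_le_halfDegree' (K : CMField) : 1 ≤ K.halfDegree := by
  have h2 := two_mul_halfDegree K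
  have hpos : 0 < Module.finrank ℚ K := Module.finrank_pos
  omega

/-- Iterated cup products of degree-one classes are the same in `U♭` and in `U` (all degrees involved are positive). -/
theorem cupPow_eq (X : U.Var) (k : ℕ) (a : Fin (k + 1) → U.Coh X 1) : (U.padH0 D).cupPow X k a = U.cupPow X k a := by
  induction k with
  | zero => rfl
  | succ k ih => rw [cupPow_succ, cupPow_succ, ih]; rfl

/-- `CupExterior` (degrees `≥ 1`) is the same statement for `U♭` and `U`. -/
theorem cupExterior_iff (X : U.Var) (k : ℕ) : (U.padH0 D).CupExterior X k ↔ U.CupExterior X k := by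
  constructor
  · rintro ⟨e, he, h⟩
    exact ⟨e, he, fun a => (h a).trans (cupPow_eq X k a)⟩
  · rintro ⟨e, he, h⟩
    exact ⟨e, he, fun a => (h a).trans (cupPow_eq X k a).symm⟩

section Weights

variable {F : CMField} {n : ℕ} (Θ : Fin (n + 1) → CMType F)

set_option smartUnfolding false in
/-- The CM products of `U♭` are those of `U` (definitionally). -/
theorem cmProd_eq : (U.padH0 D).cmProd F Θ = U.cmProd F Θ := rfl

set_option smartUnfolding false in
/-- Factor-wise CM actions (a degree-one condition) are the same in `U♭` and in `U`. -/
theorem isFactorAct_iff (j : Fin (n + 1)) (a : F) (M : U.Mor (U.cmProd F Θ) (U.cmProd F Θ)) :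
    (U.padH0 D).IsFactorAct F Θ j a M ↔ U.IsFactorAct F Θ j a M := Iff.rfl

set_option smartUnfolding false in
/-- The geometric component of a weight vector of `U♭` is a weight vector of `U` of the same weight and degree. -/
theorem isWeightVector_toUC {S : Fin (n + 1) → Finset ((F : Type) →+* ℂ)} {k : ℕ}
    {x : (U.padH0 D).CohC ((U.padH0 D).cmProd F Θ) k} (hx : (U.padH0 D).IsWeightVector F Θ S k x) :
    U.IsWeightVector F Θ S k (toUC D (U.cmProd F Θ) k x) := by
  intro j a M hM
  have h := congrArg (toUC D (U.cmProd F Θ) k) (hx j a M ((isFactorAct_iff Θ j a M).mpr hM))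
  exact (toUC_pullC (D := D) M k x).symm.trans (h.trans (map_smul _ _ _))

set_option smartUnfolding false in
/-- **The pad component of a weight vector of `U♭` of weight `S` is an eigenvector of the pad actions `P(M) ⊗ ℂ` of the
factor-wise CM multiplications `M`, with the eigencharacter of `S`.** -/
theorem padOfC_weightVector {S : Fin (n + 1) → Finset ((F : Type) →+* ℂ)} {k : ℕ}
    {x : (U.padH0 D).CohC ((U.padH0 D).cmProd F Θ) k} (hx : (U.padH0 D).IsWeightVector F Θ S k x)
    (j : Fin (n + 1)) (a : F) (M : U.Mor (U.cmProd F Θ) (U.cmProd F Θ)) (hM : U.IsFactorAct F Θ j a M) :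
    (D.map M).baseChange ℂ (padOfC D (U.cmProd F Θ) k x) = (∏ s ∈ S j, s a) • padOfC D (U.cmProd F Θ) k x := by
  have h := congrArg (padOfC D (U.cmProd F Θ) k) (hx j a M ((isFactorAct_iff Θ j a M).mpr hM))
  exact (padOfC_pullC (D := D) M k x).symm.trans (h.trans (map_smul _ _ _))


-- port_pkg: scope closed for this part
end Weights
end PadH0
end Universe
end HodgeCM
end
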